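import Summits.CriticalPhenomena.PercolationContinuityZ3.Theorems.PercNearOneGluingNoHeavyQuantSDEC
import HarnessLib

/-!
# QUANT lane: the `d = 0` row of the two-layer-bound family is Markov's inequality — for every top-affordable law,
# in particular for every gated factor and for the gated convolution (the `d = 0` row of the heavy node, ANY floor, ANY gate)

builds on p205010 (kernel theorem, internal audit signed; external expert review pending)

Support file (`--supports stmt-CriticalPhenomena-4575`), QUANT lane seat prim-quant-arm-3 (gen 165), memo
`run/shared/lean/prim/quant/prim-quant-arm-3-g165/ARM3-PHANTOM-K0.md` §5.

THE OBSERVATION.  The `d = 0` row of `LawDec.TLB u τ M ν` (file `…QuantTLBClosure`), `u·ν{0} ≤ ν{h : τ ≤ h}` with `u = y/(1−y)`,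
holds for EVERY nonnegative law `ν` on `{0..M}` of mass `1` whose mean is at least `τ > 0` and which is top-affordable, `y·M ≤ τ`:
integrate the pointwise inequality `(u/τ)·(h − mean) ≤ [τ ≤ h] − u·[h = 0]` on `{0..M}` (at `h = 0` it is `mean ≥ τ`; for `0 < h < τ`
the left side is negative; for `τ ≤ h ≤ M ≤ τ/y` it is `≤ (u/τ)(τ/y − τ) = 1`).  No hypothesis on the shape of `ν`, no restriction on
the floor `y ∈ (0,1)`.  Since gating preserves "mean = target" (`mean (gate μ q) = q·T`) and top-affordability is additive, the
`d = 0` row of the conclusion of `LawDec.TLBGateConvClosed` / the heavy node holds unconditionally (`gateConv_rowZero`): the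
explicit certificate D0T of the lane memo PHANTOM-K0-G37 (one reflection + mean tilts, orientation `t₂ ≤ t₁`, `1/2 ≤ y`) proves a
statement that needs none of its hypotheses beyond the two means and top-affordability.

* `LawDec.rowZero_markov`   — the row for an arbitrary top-affordable law with mean `≥ τ`.
* `LawDec.gate_rowZero`     — the row for `gate μ q` at target `q·T` (`T` = mean of `μ`), given `y·M ≤ q·T`.
* `LawDec.gateConv_rowZero` — the row for `gate (lconv M₁ M₂ μ₁ μ₂) q` at target `q·(T₁+T₂)` on `{0..M₁+M₂}`, given `y·Mᵢ ≤ q·Tᵢ`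
  (exactly the `d = 0` instance of the conclusion of `TLBGateConvClosed`, whose other rows are refuted for `y < 1/2` by
  `not_tlbGateConvClosed` and conjectured for `1/2 ≤ y`).

[this work]; the rows served belong to the gluing programme of [cite: KozmaNitzan2024, Conjecture 3 (p. 15)].
-/

noncomputable section

namespace Summit.CriticalPhenomena.PercolationContinuityZ3.Theorems

namespace Quant

open Finset

namespace LawDec

/-- **The `d = 0` two-layer row is Markov.**  For a nonnegative law `ν` on `{0..M}` of mass `1` with mean at least `τ > 0` and
top-affordable at floor `y ∈ (0,1)` (`y·M ≤ τ`): `y/(1−y) · ν 0 ≤ Σ_{h ≤ M, τ ≤ h} ν h`.  Proof: sum the pointwise inequality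
`[τ ≤ h]·ν h − u·[h = 0]·ν h − (u/τ)·(h − mean)·ν h ≥ 0` over `h ≤ M`. [this work] -/
theorem rowZero_markov {y τ : ℝ} {M : ℕ} {ν : ℕ → ℝ} (hy0 : 0 < y) (hy1 : y < 1) (hτ : 0 < τ)
    (hν : ∀ h, 0 ≤ ν h) (hν1 : ∑ h ∈ Finset.range (M + 1), ν h = 1)
    (hmean : τ ≤ ∑ h ∈ Finset.range (M + 1), (h : ℝ) * ν h) (hTA : y * (M : ℝ) ≤ τ) :
    y / (1 - y) * ν 0 ≤ ∑ h ∈ Finset.range (M + 1), (if τ ≤ (h : ℝ) then ν h else 0) := by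
  set m : ℝ := ∑ h ∈ Finset.range (M + 1), (h : ℝ) * ν h with hm
  have h1y : 0 < 1 - y := by linarith
  set u : ℝ := y / (1 - y) with hu
  have hu0 : 0 < u := div_pos hy0 h1y
  set r : ℝ := u / τ with hr
  have hr0 : 0 < r := div_pos hu0 hτ
  -- the budget at the top: r * (M - τ) ≤ 1
  have hMτ : (M : ℝ) - τ ≤ τ * (1 - y) / y := by
    rw [le_div_iff₀ hy0]
    nlinarith
  have htop : r * ((M : ℝ) - τ) ≤ 1 := by
    calc r * ((M : ℝ) - τ) ≤ r * (τ * (1 - y) / y) := mul_le_mul_of_nonneg_left hMτ hr0.le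
      _ = 1 := by
        rw [hr, hu]
        field_simp
  -- mean at the origin: u ≤ r * m
  have horig : u ≤ r * m := by
    rw [hr, div_mul_eq_mul_div, le_div_iff₀ hτ]
    exact mul_le_mul_of_nonneg_left hmean hu0.le
  -- termwise inequality
  have key : ∀ h ∈ Finset.range (M + 1),
      0 ≤ (if τ ≤ (h : ℝ) then ν h else 0) - u * (if h = 0 then ν h else 0) - r * (((h : ℝ) - m) * ν h) := by
    intro h hh
    rw [Finset.mem_range] at hh
    have hhM : (h : ℝ) ≤ M := by exact_mod_cast Nat.lt_succ_iff.mp hh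
    have hνh := hν h
    by_cases h0 : h = 0
    · subst h0
      have hτ0 : ¬ τ ≤ ((0 : ℕ) : ℝ) := by rw [Nat.cast_zero]; exact not_le.mpr hτ
      rw [if_neg hτ0, if_pos rfl, Nat.cast_zero]
      nlinarith
    · rw [if_neg h0]
      by_cases ht : τ ≤ (h : ℝ)
      · rw [if_pos ht]
        have hrm : r * ((h : ℝ) - m) ≤ 1 := by
          calc r * ((h : ℝ) - m) ≤ r * ((M : ℝ) - τ) := by
                apply mul_le_mul_of_nonneg_left _ hr0.le
                linarith
            _ ≤ 1 := htop
        nlinarith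
      · rw [if_neg ht]
        have ht' : (h : ℝ) < τ := not_le.mp ht
        have h3 : 0 ≤ r * ((m - (h : ℝ)) * ν h) := mul_nonneg hr0.le (mul_nonneg (by linarith) hνh)
        have h4 : r * (((h : ℝ) - m) * ν h) = -(r * ((m - (h : ℝ)) * ν h)) := by ring
        rw [h4]
        linarith
  have hsum := Finset.sum_nonneg key
  have e1 : ∑ h ∈ Finset.range (M + 1), u * (if h = 0 then ν h else 0) = u * ν 0 := by
    rw [← Finset.mul_sum, Finset.sum_ite_eq' (Finset.range (M + 1)) 0, if_pos (Finset.mem_range.2 (Nat.succ_pos M))]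
  have e2 : ∑ h ∈ Finset.range (M + 1), r * (((h : ℝ) - m) * ν h) = 0 := by
    have hz : ∑ h ∈ Finset.range (M + 1), (((h : ℝ) - m) * ν h) = 0 := by
      simp only [sub_mul, Finset.sum_sub_distrib, ← Finset.mul_sum, hν1, mul_one]
      rw [hm]
      ring
    rw [← Finset.mul_sum, hz, mul_zero]
  rw [Finset.sum_sub_distrib, Finset.sum_sub_distrib, e1, e2, sub_zero] at hsum
  linarith

/-- nonnegativity of a gated law (`0 ≤ q ≤ 1`); private copy of `gate_nonneg'` (…QuantTwoLayerClosure) to keep the imports minimal. [this work] -/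
private theorem gate_nonneg_le_one {μ : ℕ → ℝ} {q : ℝ} (hμ : ∀ h, 0 ≤ μ h) (hq0 : 0 ≤ q) (hq1 : q ≤ 1) (h : ℕ) :
    0 ≤ gate μ q h := by
  simp only [gate]
  split_ifs
  · nlinarith [hμ h]
  · rw [add_zero]; exact mul_nonneg hq0 (hμ h)

/-- **The `d = 0` row of a gated top-affordable law is free.**  For a law `μ` on `{0..M}` (nonnegative, mass `1`, mean `T`), a gate
`0 < q ≤ 1` and a floor `0 < y < 1` with `y·M ≤ q·T` and `0 < q·T`:  `y/(1−y) · (gate μ q) 0 ≤ Σ_{h ≤ M, q·T ≤ h} (gate μ q) h` —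
the `d = 0` row of `TLB (y/(1−y)) (q·T) M (gate μ q)`, with no hypothesis on the shape of `μ`. [this work] -/
theorem gate_rowZero {y q : ℝ} {M : ℕ} {μ : ℕ → ℝ} (hy0 : 0 < y) (hy1 : y < 1) (hq0 : 0 < q) (hq1 : q ≤ 1)
    (hμ : ∀ h, 0 ≤ μ h) (hμ1 : ∑ h ∈ Finset.range (M + 1), μ h = 1)
    (hpos : 0 < q * ∑ h ∈ Finset.range (M + 1), (h : ℝ) * μ h)
    (hTA : y * (M : ℝ) ≤ q * ∑ h ∈ Finset.range (M + 1), (h : ℝ) * μ h) :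
    y / (1 - y) * gate μ q 0 ≤
      ∑ h ∈ Finset.range (M + 1), (if q * (∑ k ∈ Finset.range (M + 1), (k : ℝ) * μ k) ≤ (h : ℝ) then gate μ q h else 0) :=
  rowZero_markov hy0 hy1 hpos (gate_nonneg_le_one hμ hq0.le hq1) (sum_gate μ q M hμ1)
    (by rw [sum_mul_gate]) hTA

/-- **The `d = 0` row of the gated convolution is free (the `d = 0` instance of the conclusion of `TLBGateConvClosed` /
the heavy node, for EVERY floor `0 < y < 1` and gate `0 < q ≤ 1`).**  For laws `μ₁` on `{0..M₁}`, `μ₂` on `{0..M₂}` (nonnegative,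
mass `1`, means `T₁, T₂`) with `y·Mᵢ ≤ q·Tᵢ` and `0 < q·(T₁ + T₂)`:
`y/(1−y) · (gate (lconv M₁ M₂ μ₁ μ₂) q) 0 ≤ Σ_{h ≤ M₁+M₂, q(T₁+T₂) ≤ h} (gate (lconv M₁ M₂ μ₁ μ₂) q) h`.
No two-layer / DEC hypothesis on the factors, no orientation, no `1/2 ≤ y`. [this work] -/
theorem gateConv_rowZero {y q : ℝ} {M₁ M₂ : ℕ} {μ₁ μ₂ : ℕ → ℝ} (hy0 : 0 < y) (hy1 : y < 1) (hq0 : 0 < q) (hq1 : q ≤ 1)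
    (h10 : ∀ h, 0 ≤ μ₁ h) (h11 : ∑ h ∈ Finset.range (M₁ + 1), μ₁ h = 1)
    (h20 : ∀ h, 0 ≤ μ₂ h) (h21 : ∑ h ∈ Finset.range (M₂ + 1), μ₂ h = 1)
    (hpos : 0 < q * ((∑ h ∈ Finset.range (M₁ + 1), (h : ℝ) * μ₁ h) + ∑ h ∈ Finset.range (M₂ + 1), (h : ℝ) * μ₂ h))
    (hTA1 : y * (M₁ : ℝ) ≤ q * ∑ h ∈ Finset.range (M₁ + 1), (h : ℝ) * μ₁ h)
    (hTA2 : y * (M₂ : ℝ) ≤ q * ∑ h ∈ Finset.range (M₂ + 1), (h : ℝ) * μ₂ h) :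
    y / (1 - y) * gate (lconv M₁ M₂ μ₁ μ₂) q 0 ≤
      ∑ h ∈ Finset.range (M₁ + M₂ + 1),
        (if q * ((∑ k ∈ Finset.range (M₁ + 1), (k : ℝ) * μ₁ k) + ∑ k ∈ Finset.range (M₂ + 1), (k : ℝ) * μ₂ k) ≤ (h : ℝ)
          then gate (lconv M₁ M₂ μ₁ μ₂) q h else 0) := by
  have hTA : y * ((M₁ + M₂ : ℕ) : ℝ) ≤
      q * ((∑ k ∈ Finset.range (M₁ + 1), (k : ℝ) * μ₁ k) + ∑ k ∈ Finset.range (M₂ + 1), (k : ℝ) * μ₂ k) := by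
    rw [Nat.cast_add, mul_add, mul_add]
    exact add_le_add hTA1 hTA2
  refine rowZero_markov hy0 hy1 hpos (gate_nonneg_le_one (lconv_nonneg M₁ M₂ μ₁ μ₂ h10 h20) hq0.le hq1)
    (sum_gate _ q (M₁ + M₂) (sum_lconv M₁ M₂ μ₁ μ₂ h11 h21)) (le_of_eq ?_) hTA
  rw [sum_mul_gate, sum_mul_lconv M₁ M₂ μ₁ μ₂ h11 h21]

end LawDec

end Quant

end Summit.CriticalPhenomena.PercolationContinuityZ3.Theorems
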